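import Mathlib
import HarnessLib
import Summits.Langlands.Langlands.Theorems.ExteriorSquareAscentSelfTwistedIrreducibleDefs
import Literature.NumberTheory.Automorphic.ReciprocityGLnRestrictionProofs
import Literature.NumberTheory.GaloisRepresentations.RestrictFieldSemisimpleFiniteProofs
import Literature.NumberTheory.Automorphic.LanglandsTetrahedralProofs
import Literature.NumberTheory.Automorphic.BaseChangeOfAutomorphicInduction
import Literature.NumberTheory.Automorphic.SatakeParamNeZeroProofs
import Literature.NumberTheory.Automorphic.TunnellOctahedralGlobal
import Summits.Langlands.Langlands.Theorems.QuadraticWindowHostInducedRepMemberSatakeData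

/-!
# Stub `stub_descent` of line `Sketch` (idea det-pinning) for crux stmt-Langlands-18055
# `Summit.Langlands.Langlands.Theses.ExteriorSquareAscent.SelfTwistedIrreducible`

LOG (stub worker `stub_descent`, 2026-08-17).  FACT-FREE (theorems only); the registered statement
`stub_descent` of the checked skeleton `Cruxes/SelfTwistedIrreducible/Lines/Sketch.lean` is proved
verbatim, in the skeleton's namespace, from proved tree theorems.

**Statement.**  `L/K` quadratic with non-trivial automorphism `τ`, `π` cuspidal on `GL₄(𝔸_K)`
automorphically induced from the cuspidal `f` on `GL₂(𝔸_L)` (`IsAutomorphicInductionAlong f.1 π.1`)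
and with a Hecke field (`HasHeckeField π`), `ρ : Γ_K → GL₄(ℚ̄_ℓ)` semisimple and Satake–Frobenius
compatible with `(π, ι)` a.e. (`IsCompatibleWith π ι ρ`).  Then `ρ' := ρ|_{Γ_L}` is
(i) semisimple, (ii) `E`-rational a.e. (`IsRationalAE`), (iii) compatible with `f ⊞ f^τ`
(`IsCompatibleAlong τ f ι ρ'`).

**Proof.**
* (i) `FramedGaloisRep.isSemisimple_restrictField_of_finiteDimensional` (Clifford + relative
  Maschke, tree).
* (ii) Over `K` first: at a good place `v`, `charpoly ρ(Frob_v) = ∏_{a ∈ α} (X - ι⁻¹((q^{3/2} a)⁻¹))`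
  for the Satake parameter `α = t_{π,v}` (`#α = 4`, `0 ∉ α`).  Its coefficients are, up to sign and
  `ι⁻¹`, the `e_j` of the inverses of `u = q^{3/2} α`, i.e. `e_{4-j}(u) / e_4(u)`
  (`esymm_map_inv_mul_prod`, tree), and `e_j(u) = q^{3j/2} e_j(α) = q^{j(j-1)/2} · (q^{j(4-j)/2} e_j(α))`
  lies in the Hecke field `E` (`Multiset.pow_smul_esymm`).  Hence `charpoly ρ(Frob_v) ∈ e(E[X])`,
  `e = ι⁻¹|_E` (`Polynomial.lifts`), i.e. `ρ` is `E`-rational (`FramedGaloisRep.IsRationalOver`), and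
  `E`-rationality descends to `ρ|_{Γ_L}` (`FramedGaloisRep.IsRationalOver.restrictField`, tree).
* (iii) Pull the a.e.-in-`v` data (`IsAutomorphicInductionAlong.eventually_satakePolynomial_eq_iff`,
  `IsCompatibleWith`, `v` unramified in `L`) back to a.e.-in-`w` (`eventually_under`); at `w ∣ v`,
  `charpoly ρ'(Frob_w) = arithFrobPolyOfSatake ι q_w 4 (α^{f(w|v)})`
  (`hasFrobCharpolyAt_restrictField_arithFrobPolyOfSatake`, tree), and `α^{f(w|v)} = t_{f,w} + t_{f,τw}`:
  split `v` (`induced_split`: `f = 1`, `α = β_w + β_{τw}`), inert `v` (`induced_inert`: `f = 2`,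
  `∏ (X - a) = P_{β_w}(X²)`, so `α² = 2 • β_w`, `Multiset.map_pow_eq_nsmul_sum_of_satakePolynomial_eq`).

References: Arthur–Clozel 1989, Ch. 3, Def. 6.1, (6.1)–(6.2) [ArthurClozelAMS120]; Böckle–Hui 2025,
§2.7 [BockleHui2025]; Clozel 1990, §3 (Hecke field) [Clozel1990].
-/

noncomputable section

set_option linter.dupNamespace false -- `Summit.Langlands.Langlands` is the mandated namespace

namespace Summit.Langlands.Langlands.Cruxes.SelfTwistedIrreducible.DetPinning

open scoped NumberField Polynomial Classical
open Filter Polynomial NumberField IsDedekindDomain Field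
open Literature.NumberTheory.GaloisRepresentations Literature.NumberTheory.Automorphic
open Summit.Langlands.Langlands.Theorems.HostInducedRep.OneTransparentPane (induced_inert induced_split)

/-! ## Algebra: elementary symmetric functions and the Hecke field -/

section Algebra

/-- Elementary symmetric functions commute with ring homomorphisms:
`e_j(g(s)) = g(e_j(s))`. [folklore] -/
theorem esymm_map_ringHom {R S F : Type*} [CommSemiring R] [CommSemiring S] [FunLike F R S]
    [RingHomClass F R S] (g : F) (s : Multiset R) (j : ℕ) :
    (s.map g).esymm j = g (s.esymm j) := by
  simp only [Multiset.esymm, Multiset.powersetCard_map, Multiset.map_map, Function.comp_def,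
    map_multiset_sum, map_multiset_prod]

/-- **The C-normalised symmetric functions lie in the Hecke field.**  If
`q^{i(4-i)/2} e_i(α) ∈ E` for `i ≤ 4` (the Hecke-field clause at a place with residue cardinality
`q`), then `e_i(q^{3/2} α) = q^{3i/2} e_i(α) = q^{i(i-1)/2} · q^{i(4-i)/2} e_i(α) ∈ E` for `i ≤ 4`
(`3i = i(i-1) + i(4-i)`, `i(i-1)` even, `q ∈ ℚ ⊆ E`; Mathlib `Multiset.pow_smul_esymm`).
Clozel 1990, §3.3. [folklore] -/
theorem esymm_smul_mem_of_hecke (E : Subfield ℂ) (q : ℕ) (α : Multiset ℂ)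
    (hE : ∀ i ≤ 4, (((Real.sqrt (q : ℝ) : ℝ) : ℂ) ^ (i * (4 - i))) * α.esymm i ∈ E) :
    ∀ i ≤ 4, (α.map fun a => ((Real.sqrt (q : ℝ) : ℝ) : ℂ) ^ 3 * a).esymm i ∈ E := by
  intro i hi
  set c : ℂ := ((Real.sqrt (q : ℝ) : ℝ) : ℂ) with hc
  have hc2 : c ^ 2 = (q : ℂ) := by
    rw [hc, ← Complex.ofReal_pow, Real.sq_sqrt (Nat.cast_nonneg q), Complex.ofReal_natCast]
  have hsc : (α.map fun a => c ^ 3 * a).esymm i = (c ^ 3) ^ i * α.esymm i := by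
    have h := Multiset.pow_smul_esymm (c ^ 3) i α
    simp only [smul_eq_mul] at h
    exact h.symm
  rw [hsc]
  have key : (c ^ 3) ^ i * α.esymm i =
      (q : ℂ) ^ (i * (i - 1) / 2) * (c ^ (i * (4 - i)) * α.esymm i) := by
    rw [← mul_assoc, ← hc2, ← pow_mul, ← pow_mul, ← pow_add]
    congr 2
    interval_cases i <;> omega
  rw [key]
  exact mul_mem (pow_mem (natCast_mem E q) _) (hE i hi)

/-- **Symmetric functions of the inverses stay in a subfield**: if `0 ∉ u` and all `e_i(u)`,
`i ≤ #u`, lie in the subfield `E`, then so do all `e_j(u⁻¹)`, `j ≤ #u`, since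
`e_j(u⁻¹) = e_{#u-j}(u) / e_{#u}(u)` (the tree's `esymm_map_inv_mul_prod`). [folklore] -/
theorem esymm_map_inv_mem (E : Subfield ℂ) (u : Multiset ℂ) (hu : ∀ a ∈ u, a ≠ 0)
    (hE : ∀ i ≤ Multiset.card u, u.esymm i ∈ E) {j : ℕ} (hj : j ≤ Multiset.card u) :
    (u.map (·⁻¹)).esymm j ∈ E := by
  have hprod : u.prod ≠ 0 := Multiset.prod_ne_zero fun h0 => hu 0 h0 rfl
  have h1 := esymm_map_inv_mul_prod u hu (j := j) (k := Multiset.card u - j) (by omega)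
  have h0 := esymm_map_inv_mul_prod u hu (j := 0) (k := Multiset.card u) (by omega)
  have he0 : (u.map (·⁻¹)).esymm 0 = 1 := by
    simp [Multiset.esymm, Multiset.powersetCard_zero_left]
  rw [he0, one_mul] at h0
  have heq : (u.map (·⁻¹)).esymm j = u.esymm (Multiset.card u - j) / u.prod := by
    rw [eq_div_iff hprod, h1]
  rw [heq, h0]
  exact div_mem (hE _ (Nat.sub_le _ _)) (hE _ le_rfl)

/-- **Vieta descent**: if all `e_j(s)`, `j ≤ #s`, lie in the image of a ring map `e : R → S`, then
`∏_{a ∈ s} (X - a) = P^e` for some `P ∈ R[X]` (Mathlib `Multiset.prod_X_sub_C_coeff`,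
`Polynomial.lifts_iff_coeff_lifts`). [folklore] -/
theorem exists_eq_map_of_esymm_mem_range {R S : Type*} [CommRing R] [CommRing S] [Nontrivial S]
    (e : R →+* S) (s : Multiset S) (hs : ∀ j ≤ Multiset.card s, s.esymm j ∈ Set.range e) :
    ∃ P : R[X], (s.map fun a => X - C a).prod = P.map e := by
  -- adapted from Literature/NumberTheory/GaloisRepresentations/WeakAbelianDirectSummandRationalRestrictProofs.lean
  have hlift : (s.map fun a => X - C a).prod ∈ Polynomial.lifts e := by
    rw [Polynomial.lifts_iff_coeff_lifts]
    intro k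
    by_cases hk : k ≤ Multiset.card s
    · rw [Multiset.prod_X_sub_C_coeff _ hk]
      obtain ⟨x, hx⟩ := hs _ (Nat.sub_le (Multiset.card s) k)
      exact ⟨(-1) ^ (Multiset.card s - k) * x, by rw [map_mul, map_pow, map_neg, map_one, hx]⟩
    · rw [Polynomial.coeff_eq_zero_of_natDegree_lt]
      · exact ⟨0, map_zero e⟩
      · rw [Polynomial.natDegree_multiset_prod_X_sub_C_eq_card]
        exact lt_of_not_ge hk
  obtain ⟨P, hP⟩ := (Polynomial.mem_lifts _).mp hlift
  exact ⟨P, hP.symm⟩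

variable {ℓ : ℕ} [Fact ℓ.Prime]

/-- **The predicted Frobenius polynomial is Hecke-rational** (C-normalisation, rank `4`): for a
residue cardinality `q ≠ 0`, a multiset `α` of `4` non-zero complex numbers whose C-normalised
symmetric functions `q^{i(4-i)/2} e_i(α)` lie in the subfield `E ⊆ ℂ`, the polynomial
`arithFrobPolyOfSatake ι q 4 α = ∏_{a ∈ α} (X - ι⁻¹((q^{3/2} a)⁻¹))` is the image under
`e = ι⁻¹|_E : E → ℚ̄_ℓ` of a polynomial over `E`: its roots are `ι⁻¹` of the inverses of
`u = q^{3/2} α`, whose symmetric functions lie in `E` (`esymm_smul_mem_of_hecke`,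
`esymm_map_inv_mem`, `exists_eq_map_of_esymm_mem_range`).  Clozel 1990, §3.3;
Harris–Lan–Taylor–Thorne 2016, Thm. A. [folklore] -/
theorem exists_arithFrobPolyOfSatake_eq_map (ι : PadicAlgCl ℓ ≃+* ℂ) (E : Subfield ℂ) {q : ℕ}
    (hq : q ≠ 0) {α : Multiset ℂ} (hcard : Multiset.card α = 4) (hα : ∀ a ∈ α, a ≠ 0)
    (hE : ∀ i ≤ 4, (((Real.sqrt (q : ℝ) : ℝ) : ℂ) ^ (i * (4 - i))) * α.esymm i ∈ E) :
    ∃ P : Polynomial E,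
      arithFrobPolyOfSatake ι q 4 α = P.map (ι.symm.toRingHom.comp E.subtype) := by
  set c : ℂ := ((Real.sqrt (q : ℝ) : ℝ) : ℂ) with hc
  set e : E →+* PadicAlgCl ℓ := ι.symm.toRingHom.comp E.subtype with he_def
  have hc0 : c ≠ 0 := by
    rw [hc, Complex.ofReal_ne_zero]
    exact Real.sqrt_ne_zero'.mpr (by exact_mod_cast Nat.pos_of_ne_zero hq)
  set u : Multiset ℂ := α.map fun a => c ^ 3 * a with hu_def
  have hu0 : ∀ b ∈ u, b ≠ 0 := by
    intro b hb
    obtain ⟨a, ha, rfl⟩ := Multiset.mem_map.mp hb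
    exact mul_ne_zero (pow_ne_zero _ hc0) (hα a ha)
  have hucard : Multiset.card u = 4 := by rw [hu_def, Multiset.card_map, hcard]
  have huE : ∀ i ≤ Multiset.card u, u.esymm i ∈ E := by
    rw [hucard]
    exact esymm_smul_mem_of_hecke E q α hE
  set s : Multiset (PadicAlgCl ℓ) := (u.map (·⁻¹)).map ι.symm with hs_def
  have hpoly : arithFrobPolyOfSatake ι q 4 α = (s.map fun r => X - C r).prod := by
    rw [arithFrobPolyOfSatake, hs_def, hu_def, Multiset.map_map, Multiset.map_map,
      Multiset.map_map]
    rfl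
  have hs : ∀ j ≤ Multiset.card s, s.esymm j ∈ Set.range e := by
    intro j hj
    rw [hs_def, Multiset.card_map, Multiset.card_map] at hj
    rw [hs_def, esymm_map_ringHom]
    exact ⟨⟨_, esymm_map_inv_mem E u hu0 huE hj⟩, rfl⟩
  rw [hpoly]
  exact exists_eq_map_of_esymm_mem_range e s hs

end Algebra

/-! ## `E`-rationality over `K` -/

section Rational

variable {K : Type} [Field K] [NumberField K] {hcpt : isCompact_glFiniteIntegralLevel 4 K}
  {π : CuspidalAutomorphicRepData 4 K hcpt} {ℓ : ℕ} [Fact ℓ.Prime]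

/-- **A compatible `ρ` is `E`-rational for the Hecke field `E` of `π`.**  If the C-normalised
Hecke eigenvalues of `π` lie in `E ⊆ ℂ` at almost every place and `ρ : Γ_K → GL₄(ℚ̄_ℓ)` is
Satake–Frobenius compatible with `(π, ι)` almost everywhere (`IsCompatibleWith`), then `ρ` is
`E`-rational with respect to `e = ι⁻¹|_E` (`FramedGaloisRep.IsRationalOver`): at a good place,
`charpoly ρ(Frob_v) = arithFrobPolyOfSatake ι q_v 4 t_{π,v} ∈ e(E[X])`
(`exists_arithFrobPolyOfSatake_eq_map`; `#t_{π,v} = 4`, `0 ∉ t_{π,v}` by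
`hasSatakeParamAt_ne_zero_holds`).  Böckle–Hui 2025, §2.1 (E-rational compatible systems).
[folklore] -/
theorem isRationalOver_of_hasHeckeField {E : Subfield ℂ}
    (hE : ∀ᶠ v in cofinite, ∀ α : Multiset ℂ, π.1.HasSatakeParamAt v α → ∀ i ≤ 4,
      ((((Real.sqrt (v.residueCard : ℝ)) : ℝ) : ℂ) ^ (i * (4 - i))) * α.esymm i ∈ E)
    (ι : PadicAlgCl ℓ ≃+* ℂ) {ρ : FramedGaloisRep K (PadicAlgCl ℓ) 4}
    (hcomp : IsCompatibleWith π ι ρ) :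
    ρ.IsRationalOver (ι.symm.toRingHom.comp E.subtype) := by
  unfold IsCompatibleWith at hcomp
  unfold FramedGaloisRep.IsRationalOver
  filter_upwards [hE, hcomp] with v hEv hcv
  obtain ⟨α, hα, hur, hP⟩ := hcv
  refine ⟨hur, ?_⟩
  have hq : v.residueCard ≠ 0 := by have := v.one_lt_residueCard; omega
  obtain ⟨P, hPeq⟩ := exists_arithFrobPolyOfSatake_eq_map ι E hq hα.card_eq
    (hasSatakeParamAt_ne_zero_holds hα) (hEv α hα)
  refine ⟨P, ?_⟩
  rw [← hPeq]
  exact hP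

end Rational

/-! ## Compatibility with `f ⊞ f^τ` over `L` -/

section Along

variable {K : Type} [Field K] [NumberField K] {L : Type} [Field L] [NumberField L] [Algebra K L]
  {hcpt : isCompact_glFiniteIntegralLevel 4 K} {π : CuspidalAutomorphicRepData 4 K hcpt}
  {hL2 : isCompact_glFiniteIntegralLevel 2 L} {f : CuspidalAutomorphicRepData 2 L hL2}
  {ℓ : ℕ} [Fact ℓ.Prime]

/-- **Compatibility of `ρ|_{Γ_L}` with `f ⊞ f^τ`.**  If `π` on `GL₄(𝔸_K)` is automorphically
induced from `f` on `GL₂(𝔸_L)` along the quadratic `L/K` (`τ ≠ 1`) and `ρ` is compatible with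
`(π, ι)` a.e., then at almost every place `w` of `L`, for Satake parameters `β` of `f` at `w` and
`β'` at `τ • w`, `ρ|_{Γ_L}` is unramified at `w` with
`charpoly (ρ|_{Γ_L})(Frob_w) = arithFrobPolyOfSatake ι q_w 4 (β + β')`.  At `w ∣ v` with `v` good
(induction relation, compatibility, `v` unramified in `L`; `eventually_under`):
`charpoly = arithFrobPolyOfSatake ι q_w 4 (α^{f(w|v)})`, `α = t_{π,v}`
(`hasFrobCharpolyAt_restrictField_arithFrobPolyOfSatake`), and `α^{f(w|v)} = β + β'` by
`induced_split` (`f(w|v) = 1`, `α = β + β'`) or `induced_inert` (`f(w|v) = 2`, `τ • w = w`,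
`∏ (X - a) = P_β(X²)`, `α² = 2 • β`), the Satake parameters of `f` being unique
(`hasSatakeParamAt_unique_holds`).  Arthur–Clozel 1989, Ch. 3, Def. 6.1, (6.1)–(6.2);
Harris–Taylor 2001, proof of Thm. VII.1.9. [folklore] -/
theorem isCompatibleAlong_restrictField {τ : L ≃ₐ[K] L} (hτ : τ ≠ 1)
    (h2 : Module.finrank K L = 2) (hAI : IsAutomorphicInductionAlong f.1 π.1)
    (ι : PadicAlgCl ℓ ≃+* ℂ) {ρ : FramedGaloisRep K (PadicAlgCl ℓ) 4}
    (hcomp : IsCompatibleWith π ι ρ) : IsCompatibleAlong τ f ι (ρ.restrictField L) := by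
  unfold IsCompatibleWith at hcomp
  unfold IsCompatibleAlong
  have hunr : ∀ᶠ v : HeightOneSpectrum (𝓞 K) in cofinite,
      Algebra.IsUnramifiedIn (𝓞 L) v.asIdeal :=
    Filter.eventually_cofinite.2 (finite_setOf_not_isUnramifiedIn K L)
  have hgood := eventually_under (E := L)
    (hAI.eventually_satakePolynomial_eq_iff.and (hcomp.and hunr))
  filter_upwards [hgood] with w hw β β' hβ hβ'
  have hwv : w.asIdeal.under (𝓞 K) = (w.under (𝓞 K)).asIdeal := rfl
  obtain ⟨⟨βf, hβf, hiff⟩, ⟨α, hα, hur, hP⟩, hvunr⟩ := hw (w.under (𝓞 K)) hwv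
  have hB : satakePolynomial α = inducedSatakePolynomial (w.under (𝓞 K)) βf := (hiff α).mp hα
  obtain ⟨hur', hch⟩ :=
    hasFrobCharpolyAt_restrictField_arithFrobPolyOfSatake (L := L) ι ρ hwv hur 4 hP
  refine ⟨hur', ?_⟩
  have hτwv : (τ • w).asIdeal.under (𝓞 K) = (w.under (𝓞 K)).asIdeal :=
    congrArg HeightOneSpectrum.asIdeal (HeightOneSpectrum.under_algEquiv_smul K L τ w)
  have hβw : β = βf w := f.1.hasSatakeParamAt_unique_holds hβ (hβf w hwv)
  have hβ'w : β' = βf (τ • w) := f.1.hasSatakeParamAt_unique_holds hβ' (hβf (τ • w) hτwv)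
  have key : α.map (· ^ w.asIdeal.inertiaDeg (𝓞 K)) = β + β' := by
    by_cases hfix : τ • w = w
    · obtain ⟨-, hf2, hcomp2⟩ :=
        induced_inert h2 hτ (rfl : w.under (𝓞 K) = w.under (𝓞 K)) hfix hvunr hB
      rw [hf2, hβw, hβ'w, hfix]
      have h' : satakePolynomial α =
          ∏ i ∈ ({0} : Finset ℕ), (satakePolynomial (βf w)).comp (X ^ 2) := by
        rw [Finset.prod_singleton, hcomp2]
      rw [Multiset.map_pow_eq_nsmul_sum_of_satakePolynomial_eq {0} (fun _ => βf w) two_pos h',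
        Finset.sum_singleton, two_nsmul]
    · obtain ⟨-, -, hf1, -, hsum⟩ :=
        induced_split h2 hτ (rfl : w.under (𝓞 K) = w.under (𝓞 K)) hfix hB
      rw [hf1, hβw, hβ'w, ← hsum, Multiset.map_congr rfl fun a _ => pow_one a, Multiset.map_id']
  rw [← key]
  exact hch

end Along

/-- **Stub 2 of line `Sketch` (descent to `L`).**  For `L/K` quadratic with non-trivial
automorphism `τ`, `π` cuspidal on `GL₄(𝔸_K)` automorphically induced from the cuspidal `f` on
`GL₂(𝔸_L)` and with a Hecke field, and `ρ : Γ_K → GL₄(ℚ̄_ℓ)` semisimple and Satake–Frobenius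
compatible with `(π, ι)` a.e.: `ρ|_{Γ_L}` is semisimple
(`FramedGaloisRep.isSemisimple_restrictField_of_finiteDimensional`), `E`-rational a.e.
(`isRationalOver_of_hasHeckeField` + `FramedGaloisRep.IsRationalOver.restrictField`, `E` the Hecke
field), and compatible with `f ⊞ f^τ` (`isCompatibleAlong_restrictField`). [folklore] -/
theorem stub_descent :
    ∀ (K : Type) [Field K] [NumberField K] (L : Type) [Field L] [NumberField L] [Algebra K L]
      (τ : L ≃ₐ[K] L), τ ≠ 1 → Module.finrank K L = 2 →
      ∀ (hcpt : isCompact_glFiniteIntegralLevel 4 K) (π : CuspidalAutomorphicRepData 4 K hcpt)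
        (hL2 : isCompact_glFiniteIntegralLevel 2 L) (f : CuspidalAutomorphicRepData 2 L hL2),
        IsAutomorphicInductionAlong f.1 π.1 → HasHeckeField π →
          ∀ (ℓ : ℕ) [Fact ℓ.Prime] (ι : PadicAlgCl ℓ ≃+* ℂ) (ρ : FramedGaloisRep K (PadicAlgCl ℓ) 4),
            ρ.toGaloisRep.IsSemisimple → IsCompatibleWith π ι ρ →
              (ρ.restrictField L).toGaloisRep.IsSemisimple ∧ IsRationalAE (ρ.restrictField L) ∧
                IsCompatibleAlong τ f ι (ρ.restrictField L) := by
  intro K _ _ L _ _ _ τ hτ h2 hcpt π hL2 f hAI hE ℓ _ ι ρ hss hcomp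
  haveI : FiniteDimensional K L := Module.Finite.of_restrictScalars_finite ℚ K L
  refine ⟨ρ.isSemisimple_restrictField_of_finiteDimensional L hss, ?_,
    isCompatibleAlong_restrictField hτ h2 hAI ι hcomp⟩
  obtain ⟨E, hfd, hEv⟩ := hE
  haveI : FiniteDimensional ℚ E := hfd
  haveI : NumberField E := NumberField.mk
  exact ⟨E, inferInstance, inferInstance, _, (isRationalOver_of_hasHeckeField hEv ι hcomp).restrictField L⟩

end Summit.Langlands.Langlands.Cruxes.SelfTwistedIrreducible.DetPinning

end
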